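import Literature.AlgebraicGeometry.Modules.AffineTestObjects
import Literature.AlgebraicGeometry.Modules.ModuleCechHZero
import Literature.AlgebraicGeometry.Modules.ModuleCechStratumFinite
import Literature.Algebra.Homology.KerZeroOfQuasiIsoNatural
import HarnessLib

/-!
# The Grothendieck complex computes `H⁰(P ×_K T', g^*L)` on every affine test object
# (Görtz–Wedhorn II, Cor. 23.135 / (23.28.5); Mumford, *Abelian Varieties*, §5, Lemmas 1–2 and Cor. 2)

For `P → Spec K` proper, geometrically integral (flat, universally open), `T` affine with noetherian ring
`A = Γ(T, 𝒪_T)`, a finite cover `𝓥` of `P ×_K T` by affine opens with affine intersections and a line bundle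
`L`, the strictly perfect model `K• → Č•(𝓥, L)` of `Modules/ModuleCechStratumFinite`
(`exists_strictlyPerfect_quasiIso_cechComplex_of_hasRank_one'`) yields the **Grothendieck complex**
`Modules.grothendieckComplex` (finitely generated projective terms in degrees `[0, r]`, quasi-isomorphic to
the module Čech complex: `grothendieckMap`, `grothendieckComplex_spec`) such that for EVERY affine test object
`j : T' → T` (`Modules/AffineTestObjects`; `B' = Γ(T', 𝒪)` an `A`-algebra through `j♯`) there is a
`B'`-linear isomorphism

  `θ_{T'} : Γ(P ×_K T', g^*L) ≃ₗ[B'] ker(d⁰ of K• ⊗_A B')`  (**`Modules.kernelReprEquiv`**):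

`K• ⊗ B' → Č• ⊗ B'` stays a quasi-isomorphism in degree `0` (★ `Algebra/Homology/KerZeroOfQuasiIsoNatural`:
flat terms, Mumford §5 Lemma 2; `Modules.kerZeroGrothendieckEquiv`), `Č•(𝓥, L) ⊗_A B' ≅ Č•(g⁻¹𝓥, g^*L)`
termwise (`Modules.kerDZeroBaseChangeEquiv`), and `H⁰` of the module Čech complex of `g^*L` is
`Γ(g^*L, ⊤)` (`Modules/ModuleCechHZero`: `kerDZeroEquiv`). The value of `θ` on degree-`0` cochains is
recorded in `Modules.cochainBC_kernelReprEquiv` (used by the naturality file). Everything is proved; no named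
facts. Mathlib searched (pin): `Module.Flat`, `LinearMap.baseChange`, `HomologicalComplex.homology` (used);
Mathlib has no Grothendieck complex. Cell `hodgecm-mathlib`, M13 node N1 (1b) (B-p10 (g8), cut/couriered by
B-p15 (g8) per B-plan1 R140/R142); generic, books 0.

## References

* U. Görtz, T. Wedhorn, *Algebraic Geometry II: Cohomology of Schemes* (2023),
  doi:10.1007/978-3-658-43031-3: Cor. 23.135 (p. 355), Cor. 23.137, (23.28.5). [GortzWedhorn2023]
* D. Mumford, *Abelian Varieties*, TIFR Studies in Mathematics 5 (1970), §5, Lemmas 1–2, Cor. 2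
  (pp. 46–50). [MumfordAV1970]
* A. Grothendieck, EGA III₂ (Publ. Math. IHÉS 17, 1963), (6.10.5), (7.7.6). [EGA3]
-/

universe u

open CategoryTheory CategoryTheory.Limits AlgebraicGeometry TopologicalSpace Opposite MonoidalCategory
open CartesianMonoidalCategory TensorProduct
open Literature.AlgebraicGeometry.Motives Literature.Algebra.Homology

set_option backward.isDefEq.respectTransparency false

noncomputable section

namespace Literature.AlgebraicGeometry.Modules

/-! ### §3 The Grothendieck complex of `L` and the kernel representation on affine test objects -/

section Kernel

variable {K : Type u} [Field K] (P T : SchemeOver K) [IsAffine T.left]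
variable {ι : Type} [LinearOrder ι] [Fintype ι] (𝓥 : ι → (P ⊗ T).left.Opens) (L : (P ⊗ T).left.Modules)
variable (hV : ∀ s : Finset ι, s.Nonempty → IsAffineOpen (cechOpen 𝓥 s)) (hcov : ⨆ i, 𝓥 i = ⊤)

omit [IsAffine T.left] [Fintype ι] in
/-- The first differential of the module Čech complex is `d⁰`. [folklore] [cite: GortzWedhorn2023, Cor. 23.135 (p. 355)] -/
theorem cechComplex_d_zero_one_hom :
    ((cechComplex 𝓥 L (baseToTotal P T)).d 0 1).hom = OrderedCech.sysD (sectionsSystem 𝓥 L (baseToTotal P T)) 0 := by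
  have := OrderedCech.sysComplex_d (sectionsSystem 𝓥 L (baseToTotal P T)) 0
  exact congrArg ModuleCat.Hom.hom this

include hcov in
omit [IsAffine T.left] [LinearOrder ι] [Fintype ι] in
/-- The cover stays covering after base change to `T'`. [folklore] [cite: GortzWedhorn2023, Cor. 23.135 (p. 355)] -/
theorem iSup_testCover {T' : SchemeOver K} (j : T' ⟶ T) : ⨆ i, testCover P T j 𝓥 i = ⊤ := by
  change ⨆ i, testMap P T j ⁻¹ᵁ 𝓥 i = ⊤
  rw [← Scheme.Hom.preimage_iSup, hcov, Scheme.Hom.preimage_top]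

/-- Transport of kernels along an equality of linear maps under base change. [folklore] [cite: GortzWedhorn2023, Cor. 23.135 (p. 355)] -/
def kerBaseChangeCongr {A B : Type u} [CommRing A] [CommRing B] [Algebra A B] {M N : Type u} [AddCommGroup M]
    [Module A M] [AddCommGroup N] [Module A N] {f g : M →ₗ[A] N} (h : f = g) :
    LinearMap.ker (f.baseChange B) ≃ₗ[B] LinearMap.ker (g.baseChange B) := by
  subst h
  exact LinearEquiv.refl _ _

/-- `kerBaseChangeCongr` is the identity on underlying elements. [folklore] [cite: GortzWedhorn2023, Cor. 23.135 (p. 355)] -/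
theorem coe_kerBaseChangeCongr_apply {A B : Type u} [CommRing A] [CommRing B] [Algebra A B] {M N : Type u}
    [AddCommGroup M] [Module A M] [AddCommGroup N] [Module A N] {f g : M →ₗ[A] N} (h : f = g)
    (y : LinearMap.ker (f.baseChange B)) :
    ((kerBaseChangeCongr (B := B) h y : LinearMap.ker (g.baseChange B)) : B ⊗[A] M) = y := by
  subst h; rfl

/-- `kerBaseChangeCongr.symm` is the identity on underlying elements. [folklore] [cite: GortzWedhorn2023, Cor. 23.135 (p. 355)] -/
theorem coe_kerBaseChangeCongr_symm_apply {A B : Type u} [CommRing A] [CommRing B] [Algebra A B] {M N : Type u}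
    [AddCommGroup M] [Module A M] [AddCommGroup N] [Module A N] {f g : M →ₗ[A] N} (h : f = g)
    (y : LinearMap.ker (g.baseChange B)) :
    (((kerBaseChangeCongr (B := B) h).symm y : LinearMap.ker (f.baseChange B)) : B ⊗[A] M) = y := by
  subst h; rfl

variable [IsProper P.hom] [GeometricallyIntegral P.hom] [Flat P.hom] [UniversallyOpen P.hom]
  [IsNoetherianRing Γ(T.left, ⊤)] [IsLocallyNoetherian T.left] (hL : HasRank L 1)

/-- **The Grothendieck complex `K•` of the line bundle `L` on `P ×_K T`** (a choice of the strictly perfect model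
`K• → Č•(𝓥, L)` in degrees `[0, #ι]` of `exists_strictlyPerfect_quasiIso_cechComplex_of_hasRank_one'`).
[cite: GortzWedhorn2023, Cor. 23.135 (p. 355)] -/
def grothendieckComplex : CochainComplex (ModuleCat.{u} Γ(T.left, ⊤)) ℤ :=
  Classical.choose (exists_strictlyPerfect_quasiIso_cechComplex_of_hasRank_one' P T 𝓥 L hV hcov hL
    (Fintype.card ι) (by omega))

/-- The quasi-isomorphism `K• → Č•(𝓥, L)`. [cite: GortzWedhorn2023, Cor. 23.135 (p. 355)] -/
def grothendieckMap : grothendieckComplex P T 𝓥 L hV hcov hL ⟶ cechComplex 𝓥 L (baseToTotal P T) :=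
  Classical.choose (Classical.choose_spec (exists_strictlyPerfect_quasiIso_cechComplex_of_hasRank_one'
    P T 𝓥 L hV hcov hL (Fintype.card ι) (by omega)))

/-- The defining properties of the Grothendieck complex. [folklore] [cite: GortzWedhorn2023, Cor. 23.135 (p. 355)] -/
theorem grothendieckComplex_spec :
    QuasiIso (grothendieckMap P T 𝓥 L hV hcov hL) ∧ (grothendieckComplex P T 𝓥 L hV hcov hL).IsStrictlyGE 0 ∧
      (grothendieckComplex P T 𝓥 L hV hcov hL).IsStrictlyLE (Fintype.card ι : ℤ) ∧
      ∀ n, Module.Finite Γ(T.left, ⊤) ((grothendieckComplex P T 𝓥 L hV hcov hL).X n) ∧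
        Module.Projective Γ(T.left, ⊤) ((grothendieckComplex P T 𝓥 L hV hcov hL).X n) :=
  Classical.choose_spec (Classical.choose_spec (exists_strictlyPerfect_quasiIso_cechComplex_of_hasRank_one'
    P T 𝓥 L hV hcov hL (Fintype.card ι) (by omega)))

variable {T' : SchemeOver K} [IsAffine T'.left] (j : T' ⟶ T)

/-- Mumford's Lemma 2 for the Grothendieck complex: `ker(d⁰_K ⊗ B') ≃ ker(d⁰_Č ⊗ B')`. [cite: MumfordAV1970, §5, Lemma 2] -/
def kerZeroGrothendieckEquiv :
    letI := testAlgebra T j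
    LinearMap.ker (((grothendieckComplex P T 𝓥 L hV hcov hL).d 0 1).hom.baseChange Γ(T'.left, ⊤)) ≃ₗ[Γ(T'.left, ⊤)]
      LinearMap.ker (((cechComplex 𝓥 L (baseToTotal P T)).d 0 1).hom.baseChange Γ(T'.left, ⊤)) := by
  letI := testAlgebra T j
  have hsp := grothendieckComplex_spec P T 𝓥 L hV hcov hL
  haveI := hsp.1
  haveI := hsp.2.1
  haveI := hsp.2.2.1
  haveI : (cechComplex 𝓥 L (baseToTotal P T)).IsStrictlyGE 0 := isStrictlyGE_cechComplex _ _ _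
  haveI : (cechComplex 𝓥 L (baseToTotal P T)).IsStrictlyLE (Fintype.card ι : ℤ) :=
    isStrictlyLE_cechComplex _ _ _ _ (by omega)
  exact LinearEquiv.ofBijective (kerZeroBaseChangeMap (grothendieckMap P T 𝓥 L hV hcov hL) Γ(T'.left, ⊤))
    (kerZeroBaseChangeMap_bijective (grothendieckMap P T 𝓥 L hV hcov hL) Γ(T'.left, ⊤)
      (fun n => by haveI := (hsp.2.2.2 n).2; exact Module.Flat.of_projective)
      (flat_cechComplex_X 𝓥 L _ (flat_secMod_baseToTotal P T 𝓥 L hV (HasRank.isFiniteLocallyFree' hL)))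
      (Fintype.card ι : ℤ))

/-- **THE KERNEL REPRESENTATION `θ_{T'} : Γ(P ×_K T', g^*L) ≃ₗ[B'] ker(d⁰_K ⊗_A B')`** on an affine test object
`j : T' → T`: the Grothendieck complex computes `H⁰` after every affine base change (Görtz–Wedhorn II,
Cor. 23.135 with (23.28.5); Mumford §5, Lemmas 1–2). [cite: GortzWedhorn2023, Cor. 23.135 (p. 355) and (23.28.5)] -/
def kernelReprEquiv :
    letI := testAlgebra T j
    SecMod (testMod P T j L) (baseToTotal P T') ⊤ ≃ₗ[Γ(T'.left, ⊤)]
      LinearMap.ker (((grothendieckComplex P T 𝓥 L hV hcov hL).d 0 1).hom.baseChange Γ(T'.left, ⊤)) :=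
  letI := testAlgebra T j
  (kerDZeroEquiv (testCover P T j 𝓥) (testMod P T j L) (baseToTotal P T') (iSup_testCover P T 𝓥 hcov j)).trans
    ((kerDZeroBaseChangeEquiv P T j 𝓥 L hV (HasRank.isFiniteLocallyFree' hL)).symm.trans
      ((kerBaseChangeCongr (B := Γ(T'.left, ⊤)) (cechComplex_d_zero_one_hom P T 𝓥 L)).symm.trans
        (kerZeroGrothendieckEquiv P T 𝓥 L hV hcov hL j).symm))

/-- `e₄ ((e₁ ≫ e₂⁻¹ ≫ e₃⁻¹ ≫ e₄⁻¹) x) = e₃⁻¹ (e₂⁻¹ (e₁ x))` for (semi)linear equivalences over one ring. [folklore] [cite: GortzWedhorn2023, Cor. 23.135 (p. 355)] -/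
theorem trans₄_apply_symm_helper {R : Type*} [CommRing R] {M₀ M₁ M₂ M₃ M₄ : Type*} [AddCommMonoid M₀] [Module R M₀]
    [AddCommMonoid M₁] [Module R M₁] [AddCommMonoid M₂] [Module R M₂] [AddCommMonoid M₃] [Module R M₃]
    [AddCommMonoid M₄] [Module R M₄] (e₁ : M₀ ≃ₗ[R] M₁) (e₂ : M₂ ≃ₗ[R] M₁) (e₃ : M₃ ≃ₗ[R] M₂) (e₄ : M₄ ≃ₗ[R] M₃)
    (x : M₀) : e₄ ((e₁.trans (e₂.symm.trans (e₃.symm.trans e₄.symm))) x) = e₃.symm (e₂.symm (e₁ x)) := by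
  rw [LinearEquiv.trans_apply, LinearEquiv.trans_apply, LinearEquiv.trans_apply, LinearEquiv.apply_symm_apply]

omit [IsAffine T'.left] in
/-- Underlying element of `kerZeroGrothendieckEquiv v`: `(ψ⁰ ⊗ B') v`. [folklore] [cite: GortzWedhorn2023, Cor. 23.135 (p. 355)] -/
theorem coe_kerZeroGrothendieckEquiv_apply
    (v : letI := testAlgebra T j
      LinearMap.ker (((grothendieckComplex P T 𝓥 L hV hcov hL).d 0 1).hom.baseChange Γ(T'.left, ⊤))) :
    letI := testAlgebra T j
    ((kerZeroGrothendieckEquiv P T 𝓥 L hV hcov hL j v : LinearMap.ker _) :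
        Γ(T'.left, ⊤) ⊗[Γ(T.left, ⊤)] (cechComplex 𝓥 L (baseToTotal P T)).X 0) =
      ((grothendieckMap P T 𝓥 L hV hcov hL).f 0).hom.baseChange Γ(T'.left, ⊤) (v : _) := rfl

/-- **What `θ` does on cochains**: `(Θ ⊗ 1)((ψ⁰ ⊗ B')(θ x)) = (x|_{V'_i})_i` — the defining property of the kernel
representation (it is the composite of the augmentation with the inverses of the three comparison isomorphisms).
[folklore] [cite: GortzWedhorn2023, Cor. 23.135 (p. 355)] -/
theorem cochainBC_kernelReprEquiv (x : SecMod (testMod P T j L) (baseToTotal P T') ⊤) :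
    letI := testAlgebra T j
    cochainBC P T j 𝓥 L hV (HasRank.isFiniteLocallyFree' hL) 0
        (((grothendieckMap P T 𝓥 L hV hcov hL).f 0).hom.baseChange Γ(T'.left, ⊤)
          ((kernelReprEquiv P T 𝓥 L hV hcov hL j x : LinearMap.ker _) : _)) =
      cechAugment (testCover P T j 𝓥) (testMod P T j L) (baseToTotal P T') x := by
  letI := testAlgebra T j
  rw [← coe_kerZeroGrothendieckEquiv_apply]
  have h1 : kerZeroGrothendieckEquiv P T 𝓥 L hV hcov hL j (kernelReprEquiv P T 𝓥 L hV hcov hL j x) =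
      (kerBaseChangeCongr (B := Γ(T'.left, ⊤)) (cechComplex_d_zero_one_hom P T 𝓥 L)).symm
        ((kerDZeroBaseChangeEquiv P T j 𝓥 L hV (HasRank.isFiniteLocallyFree' hL)).symm
          (kerDZeroEquiv (testCover P T j 𝓥) (testMod P T j L) (baseToTotal P T') (iSup_testCover P T 𝓥 hcov j) x)) := by
    delta kernelReprEquiv
    exact trans₄_apply_symm_helper (R := Γ(T'.left, ⊤))
      (kerDZeroEquiv (testCover P T j 𝓥) (testMod P T j L) (baseToTotal P T') (iSup_testCover P T 𝓥 hcov j))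
      (kerDZeroBaseChangeEquiv P T j 𝓥 L hV (HasRank.isFiniteLocallyFree' hL))
      (kerBaseChangeCongr (B := Γ(T'.left, ⊤)) (cechComplex_d_zero_one_hom P T 𝓥 L))
      (kerZeroGrothendieckEquiv P T 𝓥 L hV hcov hL j) x
  rw [h1, coe_kerBaseChangeCongr_symm_apply]
  exact (cochainBC_kerDZeroBaseChangeEquiv_symm P T j 𝓥 L hV (HasRank.isFiniteLocallyFree' hL) _).trans
    (coe_kerDZeroEquiv_apply _ _ _ _ x)

end Kernel

end Literature.AlgebraicGeometry.Modules

end
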